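import Summits.HodgeConjecture.HodgeConjecture.Theorems.Ring2AbelianAllAndreFibreClassBalancedNoGo
import Literature.AlgebraicGeometry.HodgeTheory.ThomGysinDivisor
import Literature.AlgebraicGeometry.HodgeTheory.SaitoGrFDeRhamCurveNetHolds
import Literature.AlgebraicGeometry.HodgeTheory.GysinFormalismPushforward
import Literature.AlgebraicGeometry.HodgeTheory.GysinFormalismCorrespondences
import Literature.AlgebraicGeometry.HodgeTheory.HyperplaneSectionMonodromySmoothLocus
import Literature.AlgebraicGeometry.Motives.CurveNet
import Literature.AlgebraicGeometry.Motives.ProjectiveSpaceCells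
import Literature.AlgebraicGeometry.Motives.VarietiesUnitProofs
import HarnessLib

/-!
# Ring 2 · sub-cell AbelianAll (ALL ABELIAN VARIETIES), André axis, part XVI-c — the fibre class is pulled back
# from the base, `[𝒳_t] ∈ f^* H²(S)`, and RELATIVE CORRESPONDENCES ARE BALANCED: every class pushed forward from
# a smooth projective `W` along a pair `(a, b) : W → 𝒳 × 𝒳` with `a ≫ f = b ≫ f` (a correspondence OVER `S`)
# commutes with the fibre class — hence (part XV-a) never witnesses a clause of the fibre-class Lefschetz
# node (β′_f). Kernel form of part XV-a's "print dictionary (1)"; owed item (o19) of RING2-MAP AA2.56.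

HONEST FRAMING (page 1, verbatim): **research route, not a corollary; conditional on HC_CM plus one named
minimal statement.** Cell line: research route conditional on HC_CM; not a corollary; Q11.4-sentence-2
already refuted in dim ≥ 3. Nothing in this file proves a case of the Hodge conjecture for an abelian variety.
`HC_CM` = `Theses.RankFourFaces.CMAbelianHodge` does not occur in this file; item `Theses.RankFourFaces.CMToAbelian`
(stmt-16267) OPEN and not closed here. Seat `pub-hodge-ring2-ab-andre-2`, gen 8.

## What is proved (theorems only; no definition, no named fact, no sorry; every input a tree theorem)

§1 The point class of the base curve. `isSmoothProjective_specOver` (`Spec ℂ` is smooth projective of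
dimension `0`, transport of the tree's `isSmoothProjective_unit_holds` along `specOverSelfIso`); for a complex
point `t : Spec ℂ ⟶ S` of the smooth projective curve `S` the POINT CLASS `[t] := t_* 1 ∈ H²(S(ℂ); ℂ)`
(`complexGysin` along `t`, complex orientations) is non-zero (`pointGysin_one_ne_zero`: `t` is a closed immersion,
Wirtinger, the tree's `complexGysin_one_ne_zero_of_stalkMap_surjective`), spans `H²(S(ℂ); ℂ)`
(`exists_eq_smul_pointGysin`, the tree's `exists_eq_smul_of_top`) and dies off `t`
(`restrictCompl_pointGysin_eq_zero`, support of Gysin maps).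

§2 **`[𝒳_t] ∈ f^* H²(S)`** on a compact pencil `f : 𝒳 ⟶ S` of abelian `d`-folds:
* `restrictCompl_map_base_eq_zero` — every `f^* σ`, `σ ∈ H²(S)`, dies on `(𝒳 ∖ 𝒳_t)(ℂ)` (`σ = c • [t]`, `[t]` dies
  off `t`, restriction commutes with `f^*`, and `f⁻¹(t) = 𝒳_t` set-theoretically, Mathlib
  `Scheme.Pullback.range_fst`);
* `exists_map_base_eq_smul_fiberClass` — hence `f^* σ = c • [𝒳_t]` by THOM–GYSIN EXACTNESS for the smooth divisor
  `𝒳_t ⊂ 𝒳` (`ker (H²(𝒳) → H²(𝒳 ∖ 𝒳_t)) = j_{t*} H⁰(𝒳_t)`, the tree's discharged Deligne Hodge III Cor. 8.2.8,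
  `Deligne1974_ker_restrictCompl_eq_iSup_range_complexGysin_holds`, and `H⁰(𝒳_t) = ℂ · 1`);
* `map_base_pointGysin_ne_zero` — `f^*[t] ≠ 0` (the zero SECTION `e` of the abelian scheme splits `f^*`);
* **`exists_fiberClass_eq_map_base`** — `[𝒳_t] = f^* σ_t` for some `σ_t ∈ H²(S(ℂ); ℂ)` ("`[𝒳_t] = f^*[t]`" up to
  the unit forced by the two orientation conventions, which is all that is ever used);
* `map_fiberClass_eq_of_comp_eq` — `a^*[𝒳_t] = b^*[𝒳_t]` for all `a, b : W ⟶ 𝒳` with `a ≫ f = b ≫ f`.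

§3 **RELATIVE CORRESPONDENCES ARE BALANCED** (`balanced_complexGysin_lift_of_comp_eq`): for `W` smooth projective,
`a, b : W ⟶ 𝒳` with `a ≫ f = b ≫ f`, any orientation family `μ` with Poincaré duality and any class `w` on `W`,
the class `γ = (a, b)_* w ∈ H^{2e}((𝒳 ⊗ 𝒳)(ℂ))` satisfies `γ ∪ pr₂^*[𝒳_t] = γ ∪ pr₁^*[𝒳_t]` (projection formula
`complexGysin_cup` + §2). More generally `γ ∪ pr₂^* f^* σ = γ ∪ pr₁^* f^* σ` for every `σ ∈ Hᵏ(S)`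
(`cupProduct_complexGysin_lift_map_snd_map_base`).

§4 **THE NO-GO FOR RELATIVE CORRESPONDENCES** (`map_fiberι_corrClassAction_fiberGysin_eq_zero_of_comp_eq`,
`not_fibreClassLefschetz_clause_of_comp_eq`): with `γ = (a, b)_* w` as in §3 and `T = γ^*` its correspondence
action (Voisin II (10.7), any orientations), `j_s^*(T(j_{t*} j_t^* W)) = 0` for all `W, t, s`, and `T` never
witnesses a clause `p ≤ d` of `FibreClassLefschetzOn hf` — part XV-a fed with §3. Special cases by name: the
GRAPH `(𝟙, φ)_* 1` of an endomorphism `φ` of `𝒳` OVER `S` (`φ ≫ f = f`; multiplication by `n`, isogenies,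
translations of the abelian scheme) — `not_fibreClassLefschetz_clause_of_graph_over_base`.

READING (RING2-MAP §AbelianAll gen 8). Part XV-a's dictionary item (1) — "every cycle supported on the fibre
product `𝒳 ×_S 𝒳` is balanced, hence excluded" — is now a KERNEL THEOREM in the form that covers every cycle
the print literature offers (Deninger–Murre / Künnemann / Beauville / Moonen: relative correspondences are
push-forwards of classes along maps `W → 𝒳 ×_S 𝒳 ⊂ 𝒳 × 𝒳`, i.e. along pairs `(a, b)` with `a ≫ f = b ≫ f`,
`W` a resolution of the cycle). What (β′_f) needs in degree `p ≤ d` is therefore a class on `𝒳 × 𝒳` which is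
NOT a combination of push-forwards from varieties mapping to the fibre product — it must come from a
`W → 𝒳 × 𝒳` whose two structure maps to `S` DIFFER (part XV-a AA2.52: a 2-parameter family of cycles `z_{s,t}`
on `𝒳_s × 𝒳_t`). No named fact; no Hodge-conjecture input; `HC_CM` does not occur.

References: Fulton1998 (§19.1 Prop. 19.1.1, Example 10.3.2, Prop. 1.7); FultonYoungTableaux1997 (App. B §B.1
(4)–(6), §B.2 Ex. 5); VoisinHodgeII2003 (§6.1.1 Thom–Gysin, proof of Thm. 10.17 (10.7)); DeligneHodgeIII1974
(Cor. 8.2.8); HatcherAT2002 (§3.3 Thm. 3.26, Thm. 3.30); DeningerMurre1991 (§2, Thm. 3.1); Kunnemann1993 (§3);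
Abdulali1994FamiliesAV (Conj. 5.3, Thm. 5.5 p. 1130); Hartshorne1977 (II Ex. 3.11 (a), II.3 p. 89).
-/

noncomputable section

set_option linter.dupNamespace false

namespace Summit.HodgeConjecture.HodgeConjecture.Ring2.AbelianAll

open CategoryTheory AlgebraicGeometry MonoidalCategory CartesianMonoidalCategory
open Literature.AlgebraicGeometry Literature.AlgebraicGeometry.Motives
open Literature.AlgebraicGeometry.HodgeTheory
open Literature.AlgebraicTopology.SingularHomology (singularCohomology cupProduct cupProduct_gradedComm_holds
  gysinMap_restrictCompl_eq_zero_of_field HomologicalOrientation)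

variable {𝒳 S : SchemeOver ℂ}

/-! ## §1 The point class of the base curve -/

/-- `Spec ℂ` (the source of every complex point) is a smooth projective variety of dimension `0` (the tree's
`isSmoothProjective_unit_holds` for the monoidal unit, transported along `specOverSelfIso`).
[cite: Hartshorne1977, Ch. III Prop. 10.1(a) and Ch. II Ex. 4.8(e)] -/
theorem isSmoothProjective_specOver : IsSmoothProjective 0 (specOver ℂ ℂ) :=
  IsSmoothProjective.of_iso (AffineLineProduct.specOverSelfIso ℂ).symm (isSmoothProjective_unit_holds ℂ)

/-- **The point class is non-zero**: for a complex point `t : Spec ℂ ⟶ S` of a smooth projective curve `S`,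
`[t] := t_* 1 ≠ 0` in `H²(S(ℂ); ℂ)` (`t` is a closed immersion, so its stalk maps are surjective; Wirtinger /
the tree's `complexGysin_one_ne_zero_of_stalkMap_surjective`). [cite: GriffithsHarrisPrinciples1978, Ch. 0 §7 (pp. 109–111)]
[cite: FultonYoungTableaux1997, Appendix B §B.1 (5)] -/
theorem pointGysin_one_ne_zero (hS : IsSmoothProjective 1 S) (t : ComplexPoints S) :
    complexGysin complexOrientationFamily isSmoothProjective_specOver hS t
      (show 0 + 2 * 1 = 2 * (0 + 1) + 2 * 0 by rfl) (singularCohomology.one ℂ (ComplexPoints (specOver ℂ ℂ))) ≠ 0 := by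
  haveI : IsProper S.hom := IsSmoothProjective.isProper_holds hS
  haveI : IsClosedImmersion t.left := CurveNet.isClosedImmersion_left_of_isSeparated t
  let P : ComplexPoints (specOver ℂ ℂ) := 𝟙 _
  exact complexGysin_one_ne_zero_of_stalkMap_surjective complexOrientationFamily hS isSmoothProjective_specOver
    t P (t.left.stalkMap_surjective P.pt) (e := 0 + 1) (by rfl)

/-- **`H²(S(ℂ); ℂ) = ℂ · [t]`** for a smooth projective curve `S` (top degree of a connected closed surface,
the tree's `exists_eq_smul_of_top`). [cite: HatcherAT2002, §3.3 Thm. 3.26 and §3.1 Thm. 3.2] -/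
theorem exists_eq_smul_pointGysin (hS : IsSmoothProjective 1 S) (t : ComplexPoints S)
    (σ : complexBetti S (2 * (0 + 1))) :
    ∃ c : ℂ, σ = c • complexGysin complexOrientationFamily isSmoothProjective_specOver hS t
      (show 0 + 2 * 1 = 2 * (0 + 1) + 2 * 0 by rfl) (singularCohomology.one ℂ (ComplexPoints (specOver ℂ ℂ))) :=
  exists_eq_smul_of_top complexOrientationFamily hS (pointGysin_one_ne_zero hS t) σ

/-- **The point class dies off the point**: `[t]` restricts to `0` on `(S ∖ t)(ℂ)` (support of Gysin maps,
Fulton App. B §B.2 Ex. 5, the tree's `complexGysin_restrictCompl_eq_zero`; the complement of `t⁻¹(t)` in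
`Spec ℂ` has no complex points). [cite: FultonYoungTableaux1997, Appendix B §B.2 Exercise 5] -/
theorem restrictCompl_pointGysin_eq_zero (hS : IsSmoothProjective 1 S) (t : ComplexPoints S) :
    complexBetti.restrictCompl S (Set.range t.left.base) (2 * (0 + 1))
      (complexGysin complexOrientationFamily isSmoothProjective_specOver hS t
        (show 0 + 2 * 1 = 2 * (0 + 1) + 2 * 0 by rfl) (singularCohomology.one ℂ (ComplexPoints (specOver ℂ ℂ)))) = 0 := by
  haveI : IsProper S.hom := IsSmoothProjective.isProper_holds hS
  haveI : IsClosedImmersion t.left := CurveNet.isClosedImmersion_left_of_isSeparated t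
  have hcl : IsClosed (Set.range t.left.base) := t.left.isClosedMap.isClosed_range
  refine complexGysin_restrictCompl_eq_zero (gysinMap_restrictCompl_eq_zero_of_field ℂ) complexOrientationFamily
    hasPoincareDuality_complexOrientationFamily isSmoothProjective_specOver hS t _ hcl _ ?_
  haveI : IsEmpty (Motives.complexPointsCompl (specOver ℂ ℂ) (t.left.base ⁻¹' Set.range t.left.base)) :=
    ⟨fun P ↦ P.2 ⟨P.1.pt, rfl⟩⟩
  haveI := ModuleCat.subsingleton_of_isZero (Motives.isZero_singularCohomology_of_isEmpty ℂ ℂ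
    (E := Motives.complexPointsCompl (specOver ℂ ℂ) (t.left.base ⁻¹' Set.range t.left.base)) (2 * 0))
  exact Subsingleton.elim _ _

/-! ## §2 The fibre class is pulled back from the base: `[𝒳_t] ∈ f^* H²(S)` -/

/-- **Every `f^* σ`, `σ ∈ H²(S(ℂ); ℂ)`, dies on `(𝒳 ∖ 𝒳_t)(ℂ)`**: `σ = c • [t]`, `[t]` dies off `t`, restriction
commutes with pull-back (`complexBetti.restrictCompl_map_eq_zero`), and `f⁻¹(t) ⊆ 𝒳_t` set-theoretically
(Mathlib `Scheme.Pullback.range_fst`). [cite: FultonYoungTableaux1997, Appendix B §B.2 Exercise 5] [cite: Hartshorne1977, II.3 (p. 89)] -/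
theorem restrictCompl_map_base_eq_zero {d : ℕ} {f : 𝒳 ⟶ S} (hf : IsCompactAbelianPencil f d)
    (t : ComplexPoints S) (σ : complexBetti S (2 * (0 + 1))) :
    complexBetti.restrictCompl 𝒳 (Set.range (fiberι f t).left.base) (2 * (0 + 1))
      (complexBetti.map f (2 * (0 + 1)) σ) = 0 := by
  have hS := hf.isSmoothProjective_base
  obtain ⟨c, rfl⟩ := exists_eq_smul_pointGysin hS t σ
  rw [map_smul, map_smul, smul_eq_zero]
  refine Or.inr (complexBetti.restrictCompl_eq_zero_of_subset ?_
    (complexBetti.restrictCompl_map_eq_zero f (restrictCompl_pointGysin_eq_zero hS t)))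
  -- `f⁻¹(t(Spec ℂ)) ⊆ 𝒳_t(…)`: the fibre square
  intro x hx
  have hrange : Set.range (Limits.pullback.fst f.left t.left).base = f.left.base ⁻¹' Set.range t.left.base :=
    Scheme.Pullback.range_fst _ _
  have hx' : x ∈ Set.range (Limits.pullback.fst f.left t.left).base := by
    rw [hrange]
    exact hx
  exact hx'

/-- **`f^* σ = c • [𝒳_t]`** for every `σ ∈ H²(S(ℂ); ℂ)`: `f^* σ` dies on `(𝒳 ∖ 𝒳_t)(ℂ)`, so by THOM–GYSIN
EXACTNESS for the smooth divisor `𝒳_t ⊂ 𝒳` (`ker (H²(𝒳) → H²(𝒳 ∖ 𝒳_t)) = j_{t*} H⁰(𝒳_t)`, Deligne Hodge III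
Cor. 8.2.8 — a tree theorem, `Deligne1974_ker_restrictCompl_eq_iSup_range_complexGysin_holds`) it is `j_{t*} u`
with `u ∈ H⁰(𝒳_t(ℂ); ℂ) = ℂ · 1` (`𝒳_t(ℂ)` connected). [cite: DeligneHodgeIII1974, Cor. 8.2.8]
[cite: VoisinHodgeII2003, §6.1.1 (Thom–Gysin sequence before (6.3))] [cite: HatcherAT2002, §3.3 Thm. 3.26] -/
theorem exists_map_base_eq_smul_fiberClass {d : ℕ} {f : 𝒳 ⟶ S} (hf : IsCompactAbelianPencil f d)
    (t : ComplexPoints S) (σ : complexBetti S (2 * (0 + 1))) :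
    ∃ c : ℂ, complexBetti.map f (2 * (0 + 1)) σ =
      c • fiberGysin hf t 0 (singularCohomology.one ℂ (ComplexPoints (fiberOver f t))) := by
  have h𝒳 := hf.isSmoothProjective_total
  have hXt := hf.isSmoothProjective_fiberOver t
  have hker : complexBetti.map f (2 * (0 + 1)) σ ∈
      LinearMap.ker (complexBetti.restrictCompl 𝒳 (Set.range (fiberι f t).left.base) (0 + 2)).hom :=
    restrictCompl_map_base_eq_zero hf t σ
  rw [Deligne1974_ker_restrictCompl_eq_iSup_range_complexGysin.ker_restrictCompl_eq_range_of_divisor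
    Deligne1974_ker_restrictCompl_eq_iSup_range_complexGysin_holds complexOrientationFamily
    hasPoincareDuality_complexOrientationFamily h𝒳 hXt rfl (fiberι f t) 0, LinearMap.mem_range] at hker
  obtain ⟨u, hu⟩ := hker
  obtain ⟨c, rfl⟩ := exists_eq_smul_one complexOrientationFamily hXt u
  refine ⟨c, ?_⟩
  rw [map_smul] at hu
  rw [← hu]
  rfl

/-- **`f^*[t] ≠ 0`**: the zero section `e` of the abelian scheme (`e ≫ f = 𝟙`) splits `f^*`, and `[t] ≠ 0`.
[cite: Andre1996Motifs, §6.3 footnote (2) (p. 31)] [cite: FultonYoungTableaux1997, Appendix B §B.1 (1)] -/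
theorem map_base_pointGysin_ne_zero {d : ℕ} {f : 𝒳 ⟶ S} (hf : IsCompactAbelianPencil f d) (t : ComplexPoints S) :
    complexBetti.map f (2 * (0 + 1)) (complexGysin complexOrientationFamily isSmoothProjective_specOver
      hf.isSmoothProjective_base t (show 0 + 2 * 1 = 2 * (0 + 1) + 2 * 0 by rfl)
        (singularCohomology.one ℂ (ComplexPoints (specOver ℂ ℂ)))) ≠ 0 := by
  obtain ⟨e, he⟩ := hf.exists_section
  intro h0
  apply pointGysin_one_ne_zero hf.isSmoothProjective_base t
  have h1 := congrArg (complexBetti.map e (2 * (0 + 1))) h0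
  rwa [map_zero, ← CategoryTheory.comp_apply, ← complexBetti.map_comp, he, complexBetti.map_id,
    ModuleCat.id_apply] at h1

/-- **`[𝒳_t] ∈ f^* H²(S)`: the fibre class is the pull-back of a class of the base** (`[𝒳_t] = f^*[t]` up to the
unit relating the orientation conventions; `f^*[t] = c • [𝒳_t]` with `c ≠ 0` because `f^*[t] ≠ 0`).
[cite: Fulton1998, §19.1 proof of Prop. 19.1.1 and Prop. 1.7] [cite: VoisinHodgeI2002, §11.1.2] -/
theorem exists_fiberClass_eq_map_base {d : ℕ} {f : 𝒳 ⟶ S} (hf : IsCompactAbelianPencil f d) (t : ComplexPoints S) :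
    ∃ σ : complexBetti S (2 * (0 + 1)),
      fiberGysin hf t 0 (singularCohomology.one ℂ (ComplexPoints (fiberOver f t))) =
        complexBetti.map f (2 * (0 + 1)) σ := by
  set pt := complexGysin complexOrientationFamily isSmoothProjective_specOver hf.isSmoothProjective_base t
    (show 0 + 2 * 1 = 2 * (0 + 1) + 2 * 0 by rfl) (singularCohomology.one ℂ (ComplexPoints (specOver ℂ ℂ))) with hpt
  obtain ⟨c, hc⟩ := exists_map_base_eq_smul_fiberClass hf t pt
  have hc0 : c ≠ 0 := by
    rintro rfl
    exact map_base_pointGysin_ne_zero hf t (by rw [← hpt, hc, zero_smul])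
  refine ⟨c⁻¹ • pt, ?_⟩
  rw [map_smul, hc, smul_smul, inv_mul_cancel₀ hc0, one_smul]

/-- **`a^*[𝒳_t] = b^*[𝒳_t]` whenever `a ≫ f = b ≫ f`** (`W` arbitrary, `a, b : W ⟶ 𝒳` a "correspondence over
`S`"): both are `(a ≫ f)^* σ_t`. [cite: Fulton1998, Prop. 1.7] [cite: FultonYoungTableaux1997, Appendix B §B.1 (1)] -/
theorem map_fiberClass_eq_of_comp_eq {d : ℕ} {f : 𝒳 ⟶ S} (hf : IsCompactAbelianPencil f d) (t : ComplexPoints S)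
    {W : SchemeOver ℂ} (a b : W ⟶ 𝒳) (hab : a ≫ f = b ≫ f) :
    complexBetti.map a (2 * (0 + 1)) (fiberGysin hf t 0 (singularCohomology.one ℂ (ComplexPoints (fiberOver f t)))) =
      complexBetti.map b (2 * (0 + 1)) (fiberGysin hf t 0 (singularCohomology.one ℂ (ComplexPoints (fiberOver f t)))) := by
  obtain ⟨σ, hσ⟩ := exists_fiberClass_eq_map_base hf t
  rw [hσ, ← CategoryTheory.comp_apply, ← complexBetti.map_comp, hab, complexBetti.map_comp,
    CategoryTheory.comp_apply]

/-- More generally `a^* f^* σ = b^* f^* σ` for every class `σ` of the base, in every degree. [folklore] -/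
theorem map_map_base_eq_of_comp_eq {f : 𝒳 ⟶ S} {W : SchemeOver ℂ} (a b : W ⟶ 𝒳) (hab : a ≫ f = b ≫ f)
    {k : ℕ} (σ : complexBetti S k) :
    complexBetti.map a k (complexBetti.map f k σ) = complexBetti.map b k (complexBetti.map f k σ) := by
  rw [← CategoryTheory.comp_apply, ← complexBetti.map_comp, hab, complexBetti.map_comp, CategoryTheory.comp_apply]

/-! ## §3 Relative correspondences are balanced -/

section Balanced

variable {m : ℕ} {W : SchemeOver ℂ}

/-- **Push-forwards along pairs over the base commute with base classes.** For `W` smooth projective of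
dimension `m`, `a, b : W ⟶ 𝒳` with `a ≫ f = b ≫ f`, `𝒳` smooth projective of dimension `n`, an orientation
family `μ` with Poincaré duality, `w ∈ H^q(W(ℂ))` and `γ = (a, b)_* w ∈ H^{2e}((𝒳 ⊗ 𝒳)(ℂ))`: for every class
`σ ∈ Hᵏ(S(ℂ))`, `γ ∪ pr₂^* f^* σ = γ ∪ pr₁^* f^* σ`. Proof: graded commutativity, the projection formula
`(a,b)_*((a,b)^* x ∪ w) = x ∪ (a,b)_* w` (`complexGysin_cup`) and `(a,b)^* pr₂^* f^* σ = b^* f^* σ = a^* f^* σ =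
(a,b)^* pr₁^* f^* σ`. [cite: FultonYoungTableaux1997, Appendix B §B.1 (4)–(6)] [cite: Fulton1998, Example 10.3.2 and Prop. 1.7] -/
theorem cupProduct_complexGysin_lift_map_snd_map_base {n : ℕ} {f : 𝒳 ⟶ S} (h𝒳 : IsSmoothProjective n 𝒳)
    (hW : IsSmoothProjective m W) (a b : W ⟶ 𝒳) (hab : a ≫ f = b ≫ f) (μ : OrientationFamily)
    (hμ : μ.HasPoincareDuality) {q e k : ℕ} (hqe : q + 2 * (n + n) = 2 * e + 2 * m) (w : complexBetti W q)
    (σ : complexBetti S k) :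
    cupProduct (Nat.add_comm (2 * e) k)
        (complexGysin μ hW (h𝒳.tensor_holds h𝒳) (lift a b) hqe w)
        (complexBetti.map (snd 𝒳 𝒳) k (complexBetti.map f k σ)) =
      cupProduct (Nat.add_comm (2 * e) k)
        (complexGysin μ hW (h𝒳.tensor_holds h𝒳) (lift a b) hqe w)
        (complexBetti.map (fst 𝒳 𝒳) k (complexBetti.map f k σ)) := by
  have hXX := h𝒳.tensor_holds h𝒳
  rw [cupProduct_gradedComm_holds ℂ _ (Nat.add_comm (2 * e) k) rfl _ (complexBetti.map (snd 𝒳 𝒳) k _),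
    cupProduct_gradedComm_holds ℂ _ (Nat.add_comm (2 * e) k) rfl _ (complexBetti.map (fst 𝒳 𝒳) k _)]
  congr 1
  have h2 : complexBetti.map (lift a b) k (complexBetti.map (snd 𝒳 𝒳) k (complexBetti.map f k σ)) =
      complexBetti.map b k (complexBetti.map f k σ) := by
    rw [← CategoryTheory.comp_apply, ← complexBetti.map_comp, lift_snd]
  have h1 : complexBetti.map (lift a b) k (complexBetti.map (fst 𝒳 𝒳) k (complexBetti.map f k σ)) =
      complexBetti.map a k (complexBetti.map f k σ) := by
    rw [← CategoryTheory.comp_apply, ← complexBetti.map_comp, lift_fst]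
  rw [← complexGysin_cup hμ hW hXX (lift a b) (rfl : k + q = k + q) (show k + q + 2 * (n + n) = (k + 2 * e) + 2 * m
      by omega) hqe rfl,
    ← complexGysin_cup hμ hW hXX (lift a b) (rfl : k + q = k + q) (show k + q + 2 * (n + n) = (k + 2 * e) + 2 * m
      by omega) hqe rfl,
    h2, h1, map_map_base_eq_of_comp_eq a b hab]

/-- **RELATIVE CORRESPONDENCES ARE BALANCED with respect to the fibre class.** On a compact pencil
`f : 𝒳 ⟶ S` of abelian `d`-folds, for `W` smooth projective, `a, b : W ⟶ 𝒳` with `a ≫ f = b ≫ f` and any class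
`w` on `W`, the push-forward `γ = (a, b)_* w ∈ H^{2e}((𝒳 ⊗ 𝒳)(ℂ))` satisfies
`γ ∪ pr₂^*[𝒳_{t₀}] = γ ∪ pr₁^*[𝒳_{t₀}]` — the hypothesis `hγ` of part XV-a's no-go. In print: every cycle on
`𝒳 ×_S 𝒳` (graphs of endomorphisms / isogenies over `S`, the Poincaré bundle and relative Fourier–Mukai kernel,
Deninger–Murre projectors, Künnemann's relative `L`, `Λ`), via a resolution `W` of the cycle.
[cite: Fulton1998, §19.1 proof of Prop. 19.1.1 and Example 10.3.2] [cite: DeningerMurre1991, §2 and Thm. 3.1]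
[cite: Kunnemann1993, §3] [cite: VoisinHodgeII2003, proof of Thm. 10.17 (10.7)] -/
theorem balanced_complexGysin_lift_of_comp_eq {d : ℕ} {f : 𝒳 ⟶ S} (hf : IsCompactAbelianPencil f d)
    (hW : IsSmoothProjective m W) (a b : W ⟶ 𝒳) (hab : a ≫ f = b ≫ f) (μ : OrientationFamily)
    (hμ : μ.HasPoincareDuality) {q e : ℕ} (hqe : q + 2 * ((d + 1) + (d + 1)) = 2 * e + 2 * m)
    (w : complexBetti W q) (t₀ : ComplexPoints S) :
    cupProduct (Nat.add_comm (2 * e) (2 * (0 + 1)))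
        (complexGysin μ hW (hf.isSmoothProjective_total.tensor_holds hf.isSmoothProjective_total)
          (lift a b) hqe w)
        (complexBetti.map (snd 𝒳 𝒳) (2 * (0 + 1))
          (fiberGysin hf t₀ 0 (singularCohomology.one ℂ (ComplexPoints (fiberOver f t₀))))) =
      cupProduct (Nat.add_comm (2 * e) (2 * (0 + 1)))
        (complexGysin μ hW (hf.isSmoothProjective_total.tensor_holds hf.isSmoothProjective_total)
          (lift a b) hqe w)
        (complexBetti.map (fst 𝒳 𝒳) (2 * (0 + 1))
          (fiberGysin hf t₀ 0 (singularCohomology.one ℂ (ComplexPoints (fiberOver f t₀))))) := by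
  obtain ⟨σ, hσ⟩ := exists_fiberClass_eq_map_base hf t₀
  rw [hσ]
  exact cupProduct_complexGysin_lift_map_snd_map_base hf.isSmoothProjective_total hW a b hab μ hμ hqe w σ

end Balanced

/-! ## §4 The no-go for relative correspondences -/

/-- **No relative correspondence moves `L¹` back to the fibres**: with `γ = (a, b)_* w` (`a ≫ f = b ≫ f`) and
`T = γ^* : H^{2p+2}(𝒳) → H²ᵖ(𝒳)` its correspondence action for any orientations (`ν` with Poincaré duality),
`j_s^*(T(j_{t*} j_t^* W)) = 0` for all `W ∈ H²ᵖ(𝒳)`, `t`, `s` (part XV-a's no-go fed with §3).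
[cite: Abdulali1994FamiliesAV, Conjecture 5.3 (p. 1130)] [cite: VoisinHodgeII2003, proof of Thm. 10.17 (10.7)]
[cite: DeningerMurre1991, Thm. 3.1] -/
theorem map_fiberι_corrClassAction_fiberGysin_eq_zero_of_comp_eq {d : ℕ} {f : 𝒳 ⟶ S}
    (hf : IsCompactAbelianPencil f d) {m : ℕ} {W : SchemeOver ℂ} (hW : IsSmoothProjective m W)
    (a b : W ⟶ 𝒳) (hab : a ≫ f = b ≫ f) (μ' : OrientationFamily) (hμ' : μ'.HasPoincareDuality)
    {q e : ℕ} (hqe : q + 2 * ((d + 1) + (d + 1)) = 2 * e + 2 * m) (w : complexBetti W q)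
    (μ : HomologicalOrientation ℂ (ComplexPoints (𝒳 ⊗ 𝒳)) (2 * ((d + 1) + (d + 1))))
    (ν : HomologicalOrientation ℂ (ComplexPoints 𝒳) (2 * (d + 1))) (hν : ν.HasPoincareDuality)
    {p q' : ℕ} (hpe : 2 * (p + 1) + 2 * e = 2 * p + 2 * (d + 1)) (hq' : 2 * p + q' = 2 * (d + 1))
    (W' : complexBetti 𝒳 (2 * p)) (t s : ComplexPoints S) :
    complexBetti.map (fiberι f s) (2 * p)
      (corrClassAction μ ν hpe hq'
        (complexGysin μ' hW (hf.isSmoothProjective_total.tensor_holds hf.isSmoothProjective_total)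
          (lift a b) hqe w)
        (fiberGysin hf t p (complexBetti.map (fiberι f t) (2 * p) W'))) = 0 :=
  map_fiberι_corrClassAction_fiberGysin_eq_zero_of_balanced hf μ ν hν hpe hq' _ t
    (balanced_complexGysin_lift_of_comp_eq hf hW a b hab μ' hμ' hqe w t) W' t s

/-- **THE NO-GO FOR RELATIVE CORRESPONDENCES: a class pushed forward along a pair `(a, b) : W → 𝒳 × 𝒳` OVER
`S` never witnesses a clause `p ≤ d` of (β′_f)** (`FibreClassLefschetzOn hf` asks, in degree `p`, for an algebraic
`T` with `j_s^*(T(j_{t*} j_t^* W)) = j_s^* W`; here the left side vanishes identically while `j_{t₀}^* ≠ 0`).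
Covers, in print, every relative cycle of the abelian scheme `𝒳/S`. [cite: Abdulali1994FamiliesAV, Conjecture 5.3 and Theorem 5.5 (p. 1130)]
[cite: DeningerMurre1991, Thm. 3.1] [cite: Kunnemann1993, §3] [cite: Andre1996Motifs, §2.1 (p. 14) and Prop. 3.3 (p. 21)] -/
theorem not_fibreClassLefschetz_clause_of_comp_eq {d : ℕ} {f : 𝒳 ⟶ S} (hf : IsCompactAbelianPencil f d)
    {m : ℕ} {W : SchemeOver ℂ} (hW : IsSmoothProjective m W) (a b : W ⟶ 𝒳) (hab : a ≫ f = b ≫ f)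
    (μ' : OrientationFamily) (hμ' : μ'.HasPoincareDuality)
    {q e : ℕ} (hqe : q + 2 * ((d + 1) + (d + 1)) = 2 * e + 2 * m) (w : complexBetti W q)
    (μ : HomologicalOrientation ℂ (ComplexPoints (𝒳 ⊗ 𝒳)) (2 * ((d + 1) + (d + 1))))
    (ν : HomologicalOrientation ℂ (ComplexPoints 𝒳) (2 * (d + 1))) (hν : ν.HasPoincareDuality)
    {p q' : ℕ} (hpe : 2 * (p + 1) + 2 * e = 2 * p + 2 * (d + 1)) (hq' : 2 * p + q' = 2 * (d + 1)) (hp : p ≤ d) :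
    ¬ ∀ (W' : complexBetti 𝒳 (2 * p)) (t s : ComplexPoints S),
        complexBetti.map (fiberι f s) (2 * p)
          (corrClassAction μ ν hpe hq'
            (complexGysin μ' hW (hf.isSmoothProjective_total.tensor_holds hf.isSmoothProjective_total)
              (lift a b) hqe w)
            (fiberGysin hf t p (complexBetti.map (fiberι f t) (2 * p) W'))) =
          complexBetti.map (fiberι f s) (2 * p) W' := by
  obtain ⟨t₀⟩ : Nonempty (ComplexPoints S) := by
    haveI : IsIntegral S.left := IsSmoothProjective.isIntegral_holds hf.isSmoothProjective_base
    haveI : SmoothOfRelativeDimension 1 S.hom := hf.isSmoothProjective_base.smoothOfRelativeDimension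
    haveI : Infinite (ComplexPoints S) := Motives.infinite_algPoints S
    infer_instance
  exact not_fibreClassLefschetz_clause_of_balanced hf μ ν hν hpe hq' _ t₀
    (balanced_complexGysin_lift_of_comp_eq hf hW a b hab μ' hμ' hqe w t₀) hp

/-- **Graphs of endomorphisms over the base are excluded**: for `φ : 𝒳 ⟶ 𝒳` with `φ ≫ f = f` (multiplication
by `n`, an isogeny or a translation of the abelian scheme, …) the graph class `(𝟙, φ)_* 1 ∈ H^{2(d+1)}((𝒳 ⊗ 𝒳)(ℂ))`
never witnesses a clause `p ≤ d` of (β′_f). [cite: DeningerMurre1991, §2 and Thm. 3.1] [cite: Abdulali1994FamiliesAV, Conjecture 5.3 (p. 1130)] -/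
theorem not_fibreClassLefschetz_clause_of_graph_over_base {d : ℕ} {f : 𝒳 ⟶ S} (hf : IsCompactAbelianPencil f d)
    (φ : 𝒳 ⟶ 𝒳) (hφ : φ ≫ f = f) (μ' : OrientationFamily) (hμ' : μ'.HasPoincareDuality)
    (μ : HomologicalOrientation ℂ (ComplexPoints (𝒳 ⊗ 𝒳)) (2 * ((d + 1) + (d + 1))))
    (ν : HomologicalOrientation ℂ (ComplexPoints 𝒳) (2 * (d + 1))) (hν : ν.HasPoincareDuality)
    {p q' : ℕ} (hpe : 2 * (p + 1) + 2 * (d + 1) = 2 * p + 2 * (d + 1)) (hq' : 2 * p + q' = 2 * (d + 1))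
    (hp : p ≤ d) :
    ¬ ∀ (W' : complexBetti 𝒳 (2 * p)) (t s : ComplexPoints S),
        complexBetti.map (fiberι f s) (2 * p)
          (corrClassAction μ ν hpe hq'
            (complexGysin μ' hf.isSmoothProjective_total
              (hf.isSmoothProjective_total.tensor_holds hf.isSmoothProjective_total)
              (lift (𝟙 𝒳) φ) (show 0 + 2 * ((d + 1) + (d + 1)) = 2 * (d + 1) + 2 * (d + 1) by ring)
              (singularCohomology.one ℂ (ComplexPoints 𝒳)))
            (fiberGysin hf t p (complexBetti.map (fiberι f t) (2 * p) W'))) =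
          complexBetti.map (fiberι f s) (2 * p) W' :=
  not_fibreClassLefschetz_clause_of_comp_eq hf hf.isSmoothProjective_total (𝟙 𝒳) φ
    (by rw [Category.id_comp, hφ]) μ' hμ' _ _ μ ν hν hpe hq' hp

end Summit.HodgeConjecture.HodgeConjecture.Ring2.AbelianAll

end
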